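import Mathlib
import Literature.MathematicalPhysics.QuantumFieldTheory.Luscher2010.TrivializingMaps
import Literature.MathematicalPhysics.QuantumFieldTheory.Luscher2010.FlowActionSeries
import Summits.Ventures.LatticeQCDFlow.TrivializingMaps.LoopActionSeries
import HarnessLib

/-!
# `LuscherSeriesLocal` holds: the low-dimensional cases and the assembled discharge

HONEST FRAMING: exact (Metropolis-corrected) sampling algorithms for lattice gauge theory; figures of merit are
autocorrelation/cost numbers at stated couplings and volumes; no continuum-physics claim.

Lüscher, CMP 293 (2010) 899, §4.5(b), cited in the tree as the named fact `LuscherSeriesLocal d n`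
(`Literature/…/Luscher2010/FlowActionSeries.lean`). File `LoopActionSeries` proves it for `d ≥ 2`. This file
closes the remaining, degenerate dimensions and assembles the discharge
`luscherSeriesLocal_holds (d n : ℕ) : LuscherSeriesLocal d n`:

* `d = 0`: there are no links and no non-empty words; every loop action is a constant.
* `d = 1`: there are links but no plaquettes, `Δ` acts link by link, and a local sum of ANY range is a sum
  of one-link functionals — so the statement is true only because a CLOSED word (`IsClosedWord`: as many
  forward as backward steps) has trivial holonomy on `SU(n)^E` in one dimension: a non-empty closed word
  contains a backtracking pair `(μ,b)(μ,¬b)`, which contributes `U Uᴴ = 1` or `Uᴴ U = 1`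
  (`pathProd_coe_eq_one_of_closed`, induction on the length). Hence the action is constant on the field
  manifold, and the zero series `S̃^{(k)} = 0`, `Ċ^{(0)} = -S(1)`, `Ċ^{(k+1)} = 0` is a Haar-normalised local
  Lüscher series (`exists_series_of_const`). This is the one place where the closedness hypothesis of the
  cited statement is used.

References: M. Lüscher, CMP 293 (2010) 899 [Luscher2010Trivializing, arXiv:0907.5491], §4 (preamble: "a sum
of Wilson loops"), §4.3 eqs. (4.12)–(4.15), §4.5(b).
-/

namespace Summit.Ventures.LatticeQCDFlow.TrivializingMaps

open MeasureTheory
open Literature.MathematicalPhysics.QuantumFieldTheory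
open Literature.MathematicalPhysics.QuantumFieldTheory.Luscher2010
open scoped Matrix Matrix.Norms.Frobenius ContDiff

noncomputable section

/-! ## §1. Constant actions have the zero series -/

section Const

variable {d L n : ℕ} [NeZero L]

omit [NeZero L] in
/-- `∂_{e,X} 0 = 0`. [folklore] -/
theorem linkDeriv_zero_fun (e : Edge d L) (X : Matrix (Fin n) (Fin n) ℂ) :
    linkDeriv e X (fun _ : AmbConfig d L n => (0 : ℝ)) = fun _ => 0 := by
  funext W
  unfold linkDeriv
  exact deriv_const (0 : ℝ) (0 : ℝ)

/-- `Δ 0 = 0`. [folklore] -/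
theorem linkLap_zero_fun (B : SuBasis n) (W : AmbConfig d L n) :
    linkLap B (fun _ : AmbConfig d L n => (0 : ℝ)) W = 0 := by
  simp [linkLap, linkDeriv_zero_fun]

/-- **An action that is constant on the field manifold has the zero Lüscher series**: `S̃^{(k)} = 0`,
`Ċ^{(0)} = -S(1)`, `Ċ^{(k+1)} = 0` solve (4.12)–(4.15), are Haar-normalised, smooth, and local sums of every
range. [cite: Luscher2010Trivializing, §4.3 eqs. (4.12)–(4.15)] -/
theorem exists_series_of_const (B : SuBasis n) {S : AmbConfig d L n → ℝ}
    (hS : ∀ U V : GaugeConfig d L (Matrix.specialUnitaryGroup (Fin n) ℂ),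
      S (WilsonFlow.coeConfig U) = S (WilsonFlow.coeConfig V)) (C : ℕ) :
    ∃ (Sk : ℕ → AmbConfig d L n → ℝ) (c : ℕ → ℝ),
      IsLuscherSeries B S Sk c ∧ IsHaarNormalised Sk ∧ (∀ k, ContDiff ℝ ∞ (Sk k)) ∧
        ∀ k, IsLocalSum (C * (k + 1)) (Sk k) := by
  refine ⟨fun _ _ => 0, fun k => if k = 0 then -S (WilsonFlow.coeConfig fun _ => 1) else 0,
    ⟨fun U => ?_, fun k U => ?_⟩, fun k => ?_, fun k => contDiff_const, fun k => ?_⟩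
  · beta_reduce
    rw [linkLap_zero_fun, if_pos rfl, hS U fun _ => 1]
    ring
  · beta_reduce
    rw [linkLap_zero_fun, if_neg (Nat.succ_ne_zero k)]
    simp [linkDeriv_zero_fun]
  · simp
  · exact ⟨fun _ _ => 0, fun _ _ _ _ => rfl, by funext W; simp⟩

end Const

/-! ## §2. Dimension zero -/

/-- **`d = 0`**: no links, only the empty word; every loop action is constant. [cite: Luscher2010Trivializing, §4.5(b)] -/
theorem luscherSeriesLocal_zero (n : ℕ) : LuscherSeriesLocal 0 n := by
  intro shapes coef _
  refine ⟨0, ?_⟩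
  intro L _ B
  refine exists_series_of_const B (fun U V => ?_) 0
  have hw : ∀ w : PathWord 0, w = [] := fun w => Subsingleton.elim _ _
  refine Finset.sum_congr rfl fun x _ => Finset.sum_congr rfl fun w _ => ?_
  rw [hw w]
  rfl

/-! ## §3. Dimension one: closed words have trivial holonomy -/

section PathEnd

variable {d L n : ℕ}

/-- The end site of the path that starts at `x` and follows the word `w`. [folklore] -/
def pathEnd : Site d L → PathWord d → Site d L
  | x, [] => x
  | x, (μ, true) :: w => pathEnd (x.shift μ) w
  | x, (μ, false) :: w => pathEnd (x - Pi.single μ 1) w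

/-- **Concatenation of words multiplies the ordered products**: `U(C C'_x) = U(C_x) · U(C'_{end})`.
[cite: Luscher2010Trivializing, §4.4 eq. (4.19)] -/
theorem pathProd_append (W : AmbConfig d L n) :
    ∀ (u v : PathWord d) (x : Site d L), pathProd W x (u ++ v) = pathProd W x u * pathProd W (pathEnd x u) v
  | [], v, x => by simp [pathProd, pathEnd]
  | (μ, true) :: u, v, x => by
      rw [List.cons_append, pathProd_cons_true, pathProd_cons_true, pathProd_append W u v, Matrix.mul_assoc]
      rfl
  | (μ, false) :: u, v, x => by
      rw [List.cons_append, pathProd_cons_false, pathProd_cons_false, pathProd_append W u v, Matrix.mul_assoc]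
      rfl

end PathEnd

section DimOne

variable {L n : ℕ}

/-- A forward–backward backtrack contributes `U Uᴴ = 1` on `SU(n)^E`. [folklore] -/
theorem pathProd_backtrack_true (U : GaugeConfig 1 L (Matrix.specialUnitaryGroup (Fin n) ℂ)) (y : Site 1 L)
    (μ : Fin 1) (v : PathWord 1) :
    pathProd (WilsonFlow.coeConfig U) y ((μ, true) :: (μ, false) :: v) = pathProd (WilsonFlow.coeConfig U) y v := by
  have hy : y.shift μ - Pi.single μ 1 = y := by simp [Site.shift]
  rw [pathProd_cons_true, pathProd_cons_false, hy, ← Matrix.mul_assoc, WilsonFlow.coeConfig_apply,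
    WilsonFlow.mul_conjTranspose_self_SU, Matrix.one_mul]

/-- A backward–forward backtrack contributes `Uᴴ U = 1` on `SU(n)^E`. [folklore] -/
theorem pathProd_backtrack_false (U : GaugeConfig 1 L (Matrix.specialUnitaryGroup (Fin n) ℂ)) (y : Site 1 L)
    (μ : Fin 1) (v : PathWord 1) :
    pathProd (WilsonFlow.coeConfig U) y ((μ, false) :: (μ, true) :: v) = pathProd (WilsonFlow.coeConfig U) y v := by
  have hy : (y - Pi.single μ 1).shift μ = y := by simp [Site.shift]
  rw [pathProd_cons_false, pathProd_cons_true, hy, ← Matrix.mul_assoc, WilsonFlow.coeConfig_apply,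
    WilsonFlow.conjTranspose_mul_self_SU, Matrix.one_mul]

/-- A backtracking pair `(μ,b)(μ,¬b)` contributes nothing on `SU(n)^E`. [folklore] -/
theorem pathProd_backtrack (U : GaugeConfig 1 L (Matrix.specialUnitaryGroup (Fin n) ℂ)) (y : Site 1 L)
    (c : Fin 1 × Bool) (v : PathWord 1) :
    pathProd (WilsonFlow.coeConfig U) y (c :: (c.1, !c.2) :: v) = pathProd (WilsonFlow.coeConfig U) y v := by
  obtain ⟨μ, b⟩ := c
  cases b
  · exact pathProd_backtrack_false U y μ v
  · exact pathProd_backtrack_true U y μ v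

/-- In one dimension a word containing the reversal of its first letter has a backtracking pair.
[folklore] -/
theorem exists_backtrack : ∀ (l : PathWord 1) (a : Fin 1 × Bool), (a.1, !a.2) ∈ l →
    ∃ (u v : PathWord 1) (c : Fin 1 × Bool), a :: l = u ++ c :: (c.1, !c.2) :: v
  | [], a, h => by simp at h
  | c' :: l, a, h => by
      by_cases hc : c' = (a.1, !a.2)
      · exact ⟨[], l, a, by rw [hc]; rfl⟩
      · have hc' : c' = a := by
          obtain ⟨μ', b'⟩ := c'
          obtain ⟨μ, b⟩ := a
          have hμ : μ' = μ := Subsingleton.elim _ _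
          subst hμ
          have hb : b' ≠ !b := fun hb => hc (by rw [hb])
          have hb' : b' = b := by cases b <;> cases b' <;> simp_all
          rw [hb']
        have hmem : (a.1, !a.2) ∈ l := by
          rcases List.mem_cons.1 h with h | h
          · exact absurd h.symm hc
          · exact h
        obtain ⟨u, v, c, huv⟩ := exists_backtrack l a hmem
        exact ⟨a :: u, v, c, by rw [hc', huv]; rfl⟩

/-- Removing a backtracking pair keeps a word closed. [folklore] -/
theorem isClosedWord_remove {u v : PathWord 1} {c : Fin 1 × Bool}
    (h : IsClosedWord (u ++ c :: (c.1, !c.2) :: v)) : IsClosedWord (u ++ v) := by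
  intro μ
  have hμ := h μ
  obtain ⟨μc, b⟩ := c
  have hμc : μc = μ := Subsingleton.elim _ _
  subst hμc
  have hne : (μc, true) ≠ (μc, false) := by simp
  cases b <;>
    simp only [List.count_append, List.count_cons, Bool.not_false, Bool.not_true, beq_self_eq_true, if_true,
      beq_iff_eq, hne, hne.symm, if_false] at hμ ⊢ <;> omega

/-- A non-empty closed word contains the reversal of its first letter. [folklore] -/
theorem mem_reverse_of_closed {a : Fin 1 × Bool} {l : PathWord 1} (h : IsClosedWord (a :: l)) :
    (a.1, !a.2) ∈ l := by
  obtain ⟨μ, b⟩ := a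
  have hμ := h μ
  have hne : (μ, true) ≠ (μ, false) := by simp
  rw [← List.count_pos_iff]
  cases b <;>
    simp only [List.count_cons, Bool.not_false, Bool.not_true, beq_self_eq_true, if_true, beq_iff_eq, hne,
      hne.symm, if_false] at hμ ⊢ <;> omega

/-- **Closed words have trivial holonomy in one dimension**: `U(C_x) = 1` on `SU(n)^E` for every closed word
`C` and every `x` (`d = 1`: the lattice is a cycle whose closed words lift to closed walks on the line `ℤ`,
a tree). [folklore] -/
theorem pathProd_coe_eq_one_of_closed (U : GaugeConfig 1 L (Matrix.specialUnitaryGroup (Fin n) ℂ)) :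
    ∀ (N : ℕ) (w : PathWord 1), w.length ≤ N → IsClosedWord w →
      ∀ x : Site 1 L, pathProd (WilsonFlow.coeConfig U) x w = 1
  | _, [], _, _, x => rfl
  | 0, a :: l, hN, _, x => by simp at hN
  | N + 1, a :: l, hN, hcl, x => by
      obtain ⟨u, v, c, huv⟩ := exists_backtrack l a (mem_reverse_of_closed hcl)
      rw [huv] at hcl ⊢
      have hlen : (u ++ v).length ≤ N := by
        have h1 : (a :: l).length = (u ++ c :: (c.1, !c.2) :: v).length := by rw [huv]
        simp only [List.length_cons, List.length_append] at h1 hN ⊢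
        omega
      rw [pathProd_append, pathProd_backtrack, ← pathProd_append]
      exact pathProd_coe_eq_one_of_closed U N (u ++ v) hlen (isClosedWord_remove hcl) x

variable [NeZero L]

/-- In one dimension a CLOSED-loop action is constant on the field manifold. [cite: Luscher2010Trivializing, §4 (preamble)] -/
theorem loopAction_coe_const_one {shapes : Finset (PathWord 1)} (coef : PathWord 1 → ℂ)
    (hcl : ∀ w ∈ shapes, IsClosedWord w) (U V : GaugeConfig 1 L (Matrix.specialUnitaryGroup (Fin n) ℂ)) :
    loopAction shapes coef (WilsonFlow.coeConfig U) = loopAction shapes coef (WilsonFlow.coeConfig V) := by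
  refine Finset.sum_congr rfl fun x _ => Finset.sum_congr rfl fun w hw => ?_
  rw [pathProd_coe_eq_one_of_closed U w.length w le_rfl (hcl w hw) x,
    pathProd_coe_eq_one_of_closed V w.length w le_rfl (hcl w hw) x]

/-- **`d = 1`**: the zero series works, by triviality of closed holonomies. [cite: Luscher2010Trivializing, §4.5(b)] -/
theorem luscherSeriesLocal_one (n : ℕ) : LuscherSeriesLocal 1 n := by
  intro shapes coef hcl
  refine ⟨0, ?_⟩
  intro L _ B
  exact exists_series_of_const B (fun U V => loopAction_coe_const_one coef hcl U V) 0

end DimOne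

/-! ## §4. The discharge -/

/-- **`LuscherSeriesLocal` holds** (Lüscher 2010 §4.5(b), "The series (4.11) is an expansion in local terms
whose footprint on the lattice increases proportionally to the order k", for every Wilson-loop action): for
every `d`, `n`, every finite family of closed loop shapes with complex coefficients there is `C` (here `4ℓ`,
`ℓ` the maximal loop length; `0` for `d ≤ 1`) such that on every periodic lattice `(ℤ/Lℤ)^d`, `L ≥ 1`, and for
every orthonormal basis of `𝔰𝔲(n)`, the recursion (4.12)–(4.15) has a smooth, Haar-normalised solution whose
order-`k` term is a local sum of range `≤ C(k+1)`. Discharges the cited named fact of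
`Literature/…/Luscher2010/FlowActionSeries.lean`. [cite: Luscher2010Trivializing, §4.5(b)] -/
theorem luscherSeriesLocal_holds (d n : ℕ) : LuscherSeriesLocal d n := by
  rcases Nat.lt_or_ge d 2 with h | h
  · interval_cases d
    · exact luscherSeriesLocal_zero n
    · exact luscherSeriesLocal_one n
  · exact luscherSeriesLocal_of_two_le h n

end

end Summit.Ventures.LatticeQCDFlow.TrivializingMaps
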